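import Summits.AnomalousDissipation.AnomalousDissipation.Theorems.MarginalStabilityChainStrainedLayerLawClockReduction
import HarnessLib

/-!
# Crux `MarginalStabilityChain.StrainedLayerLaw` (stmt-AnomalousDissipation-3007), line `FirstLemmasR2K4`
# (log-enstrophy clock + Nash roundness): the ONE-WAY CANCELLATION LAW `M₋(t) ≤ M₋(s)` (`0 < s ≤ t`)

Support file (`--supports stmt-AnomalousDissipation-3007`; registered sub-goal `negMass_antitone` of line
`FirstLemmasR2K4`, lead c7, wave 1).

What it proves: along every classical solution `(u, v, p)` of the stretched two-dimensional Navier–Stokes layer class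
on `(0, ∞)` (viscosity `ν > 0`, period `L > 0`, normalisation `γ = ΔU = 1`) with uniform exponential shear tails on
every compact time window `[a, b] ⊂ (0, ∞)`, the mass of the NEGATIVE vorticity over one period cell,
`M₋(t) = negMass L (u t) (v t) = ∫_{x ∈ (0,L]} ∫_y max(−ω, 0)` (`ω = ∂ₓv − ∂_yu`), is NON-INCREASING in time:
`M₋(t) ≤ M₋(s)` for `0 < s ≤ t`. Vorticity of either sign is destroyed only by cancellation across the zero level set;
the stretching `e^t` of the amplitude and the compression `e^{-t}` of the `y`-extent leave the mass invariant.

Route (the circulation budget reduces the law to Kato's `L¹`-antitonicity, both LANDED):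
* `negMassLaw_negMass_eq`: for one `C²` slice with shear tails, `L`-periodic `v` and the shear far field `u → ±½`,
  `M₋ = (‖ω‖₁ + L)/2` with `‖ω‖₁ = ∫_{x ∈ (0,L]} ∫_y |ω|`. Indeed `max(−ω, 0) = (|ω| − ω)/2 = (|ω| + ∂_yu − ∂ₓv)/2`
  pointwise, `∫_y ∂_yu(x, ·) = ½ − (−½) = 1` for every `x` (`integral_dY_shear_eq_one`), and
  `∫_{x ∈ (0,L]} ∫_y ∂ₓv = 0` by periodicity (`integral_period_integral_dX_eq_zero`); all slices are integrable by the
  tails (`integrable_slice_of_abs_le_exp`, `integrableOn_strip_of_abs_le_exp`, Fubini on the strip). This is the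
  circulation identity `∫∫ω = −L` per period behind the circulation floor `stub_circulationFloor` (`M₋ ≥ L`).
* `negMass_antitone`: Kato's `L¹`-antitonicity of the conservation form `∂ₜω + div(ω(u, v − y)) = νΔω` along the
  solution, `‖ω(t)‖₁ ≤ ‖ω(s)‖₁` for `0 < s ≤ t` (`stub_vorticityUniformBounds_kato`, tools H of the sum-rule line:
  the weak vorticity balance tested against `j_ε′(ω)ψ_R`, `j_ε(r) = √(r² + ε²)`, then `ε → 0⁺`, `R → ∞`), and the
  identity above at the two instants `s`, `t` (tails constants from the window `[s/2, t + 1]`).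
No facts are cited; everything used is landed in the tree. References for the mathematics: T. Kato's inequality;
M. Ben-Artzi, Arch. Rational Mech. Anal. 128 (1994) (`L¹` theory of 2-D vorticity); A. J. Majda, A. L. Bertozzi,
*Vorticity and Incompressible Flow*, CUP 2002, §1.4 (the stretched shear-layer class; circulation per period equals
the velocity jump times the period). All `[folklore]`.
-/

-- `Summit.<Summit>.<Problem>` is the tree's mandated summit-side namespace (CONVENTIONS §2); for this
-- single-conjunct summit the two coincide, so the duplicate is deliberate.
set_option linter.dupNamespace false

noncomputable section

open scoped Topology ENNReal
open Filter Set Function MeasureTheory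

namespace Summit.AnomalousDissipation.AnomalousDissipation.Theorems.StrainedLayerLaw.LogEnstrophyClock

open Literature.Analysis.FluidPDE Literature.Analysis.FluidPDE.StretchedLayer
open Summit.AnomalousDissipation.AnomalousDissipation.Theses.MarginalStabilityChain
open Summit.AnomalousDissipation.AnomalousDissipation.Theorems.StrainedLayerLaw.StrainWorkSumRule

/-! ## The circulation identity: `M₋ = (‖ω‖₁ + L)/2` for one slice -/

section Slice

variable {L C k : ℝ} {u v : ℝ → ℝ → ℝ}

/-- `max(−r, 0) = (|r| − r)/2`, used with `r = ω = ∂ₓv − ∂_yu`: `ω₋ = (|ω| + ∂_yu − ∂ₓv)/2` pointwise. [folklore] -/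
theorem negMassLaw_negPart_eq (x y : ℝ) :
    max (-(vorticity u v x y)) 0 = (|vorticity u v x y| + dY u x y - dX v x y) / 2 := by
  have e : vorticity u v x y = dX v x y - dY u x y := rfl
  rw [e]
  rcases le_or_gt 0 (dX v x y - dY u x y) with h | h
  · rw [max_eq_right (by linarith), abs_of_nonneg h]; ring
  · rw [max_eq_left (by linarith), abs_of_neg h]; ring

/-- **The circulation identity for the negative-vorticity mass.** For a `C²` slice `(u, v)` with shear tails
`SliceTails C k u v` (`k > 0`), `v` `L`-periodic in `x` (`L > 0`) and the shear far field `u(x, ·) → ±½` at `±∞`: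
`negMass L u v = (∫_{x ∈ (0,L]} ∫_y |ω| + L)/2`. Pointwise `ω₋ = (|ω| + ∂_yu − ∂ₓv)/2`; `∫_y ∂_yu(x, ·) = 1` for every
`x` (fundamental theorem of calculus on the line) and `∫_{x ∈ (0,L]} ∫_y ∂ₓv = 0` (Fubini and periodicity); the
slices are integrable by the tails. Equivalently `∫∫ ω = −L` per period cell. [folklore] -/
theorem negMassLaw_negMass_eq (hL : 0 < L) (hk : 0 < k)
    (hu : ContDiff ℝ 2 (fun q : ℝ × ℝ => u q.1 q.2)) (hv : ContDiff ℝ 2 (fun q : ℝ × ℝ => v q.1 q.2))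
    (hpv : ∀ x y, v (x + L) y = v x y)
    (hut : ∀ x, Tendsto (fun y => u x y) atTop (𝓝 (1 / 2)))
    (hub : ∀ x, Tendsto (fun y => u x y) atBot (𝓝 (-(1 / 2)))) (hT : SliceTails C k u v) :
    negMass L u v = ((∫ x in Ioc 0 L, ∫ y, |vorticity u v x y|) + L) / 2 := by
  have hC : 0 ≤ C := hT.nonneg
  have hu1 : ContDiff ℝ 1 (fun q : ℝ × ℝ => u q.1 q.2) := hu.of_le one_le_two
  have hv1 : ContDiff ℝ 1 (fun q : ℝ × ℝ => v q.1 q.2) := hv.of_le one_le_two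
  have cuy : Continuous (fun q : ℝ × ℝ => dY u q.1 q.2) := continuous_dY hu1
  have cvx : Continuous (fun q : ℝ × ℝ => dX v q.1 q.2) := continuous_dX hv1
  have cω : Continuous (fun q : ℝ × ℝ => vorticity u v q.1 q.2) := cvx.sub cuy
  have cωa : Continuous (fun q : ℝ × ℝ => |vorticity u v q.1 q.2|) := cω.abs
  -- the tails of `∂_yu`, `∂ₓv`, `ω`
  have huy : ∀ x y, |dY u x y| ≤ C * Real.exp (-k * |y|) := fun x y => hT.abs_dY_u_le x y
  have hvx : ∀ x y, |dX v x y| ≤ C * Real.exp (-k * |y|) := fun x y => hT.abs_dX_v_le x y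
  have hω : ∀ x y, |vorticity u v x y| ≤ C * Real.exp (-k * |y|) := fun x y => tails_abs_vorticity_le hT x y
  have hωa : ∀ x y, |(|vorticity u v x y|)| ≤ C * Real.exp (-k * |y|) := fun x y => by
    rw [abs_abs]; exact hω x y
  -- slice integrability (every `x`)
  have iuy : ∀ x, Integrable fun y => dY u x y := fun x =>
    integrable_slice_of_abs_le_exp (continuous_slice_y cuy x) hk (huy x)
  have ivx : ∀ x, Integrable fun y => dX v x y := fun x =>
    integrable_slice_of_abs_le_exp (continuous_slice_y cvx x) hk (hvx x)
  have iωa : ∀ x, Integrable fun y => |vorticity u v x y| := fun x =>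
    integrable_slice_of_abs_le_exp (continuous_slice_y (f := fun a b => |vorticity u v a b|) cωa x) hk (hωa x)
  -- the slice identity `∫_y ω₋(x, ·) = (∫_y |ω(x, ·)| + 1 − ∫_y ∂ₓv(x, ·))/2`
  have inner : ∀ x, ∫ y, max (-(vorticity u v x y)) 0 =
      ((∫ y, |vorticity u v x y|) + 1 - ∫ y, dX v x y) / 2 := fun x => by
    have h1 : ∫ y, dY u x y = 1 := integral_dY_shear_eq_one hu1 hk huy hut hub x
    have i1 : Integrable fun y => |vorticity u v x y| + dY u x y := (iωa x).add (iuy x)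
    have e : (fun y => max (-(vorticity u v x y)) 0) =
        fun y => (|vorticity u v x y| + dY u x y - dX v x y) / 2 := by
      funext y; exact negMassLaw_negPart_eq x y
    rw [e, integral_div, integral_sub i1 (ivx x), integral_add (iωa x) (iuy x), h1]
  -- integrability in `x` of the slice functionals (Fubini from the strip)
  have iAbs : IntegrableOn (fun q : ℝ × ℝ => |vorticity u v q.1 q.2|) (Ioc 0 L ×ˢ univ) :=
    integrableOn_strip_of_abs_le_exp cωa hC hk fun x _ y => hωa x y
  have iVx : IntegrableOn (fun q : ℝ × ℝ => dX v q.1 q.2) (Ioc 0 L ×ˢ univ) :=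
    integrableOn_strip_of_abs_le_exp cvx hC hk fun x _ y => hvx x y
  rw [IntegrableOn, StretchedLayer.volume_restrict_strip] at iAbs iVx
  have iAbs' : Integrable (fun x => ∫ y, |vorticity u v x y|) (volume.restrict (Ioc 0 L)) :=
    iAbs.integral_prod_left
  have iVx' : Integrable (fun x => ∫ y, dX v x y) (volume.restrict (Ioc 0 L)) := iVx.integral_prod_left
  have i2 : Integrable (fun x => (∫ y, |vorticity u v x y|) + 1) (volume.restrict (Ioc 0 L)) :=
    iAbs'.add (integrable_const _)
  -- `∫_{x ∈ (0,L]} ∫_y ∂ₓv = 0`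
  have hVx0 : ∫ x in Ioc 0 L, ∫ y, dX v x y = 0 :=
    integral_period_integral_dX_eq_zero hv1 hL.le hC hk hpv hvx
  -- assemble
  have e2 : (fun x => ∫ y, max (-(vorticity u v x y)) 0) =
      fun x => ((∫ y, |vorticity u v x y|) + 1 - ∫ y, dX v x y) / 2 := by
    funext x; exact inner x
  show (∫ x in Ioc 0 L, ∫ y, max (-(vorticity u v x y)) 0) = _
  rw [e2, integral_div, integral_sub i2 iVx', integral_add iAbs' (integrable_const _), hVx0, setIntegral_const,
    Real.volume_real_Ioc_of_le hL.le]
  simp only [sub_zero, smul_eq_mul, mul_one]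

end Slice

/-! ## The stub -/

/-- **Registered sub-goal `negMass_antitone` of line `FirstLemmasR2K4` (crux `StrainedLayerLaw`,
stmt-AnomalousDissipation-3007): the one-way cancellation law.** Along every classical solution of the stretched
layer class on `(0, ∞)` (`ν, L > 0`) with shear tails on compact time windows, the negative-vorticity mass
`M₋(t) = negMass L (u t) (v t)` is non-increasing: `M₋(t) ≤ M₋(s)` for `0 < s ≤ t`. By the circulation identity
`M₋ = (‖ω‖₁ + L)/2` at the instants `s` and `t` (`negMassLaw_negMass_eq`, tails constants from the window
`[s/2, t + 1]`) this is Kato's `L¹`-antitonicity `‖ω(t)‖₁ ≤ ‖ω(s)‖₁` (`stub_vorticityUniformBounds_kato`). [folklore] -/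
theorem negMass_antitone : ∀ (ν L : ℝ), 0 < ν → 0 < L → ∀ (u v p : ℝ → ℝ → ℝ → ℝ), IsStretchedLayerNSSolutionOn (Ioi 0) ν 1 1 L u v p → (∀ a b : ℝ, 0 < a → a < b → ExpTails (Icc a b) u v) → ∀ s t : ℝ, 0 < s → s ≤ t → negMass L (u t) (v t) ≤ negMass L (u s) (v s) := by
  intro ν L hν hL u v p hsol htails s t hs hst
  obtain ⟨C, k, hk, hCk⟩ := htails (s / 2) (t + 1) (by positivity) (by linarith)
  have hS : SliceTails C k (u s) (v s) := (hCk s ⟨by linarith, by linarith⟩).1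
  have hT : SliceTails C k (u t) (v t) := (hCk t ⟨by linarith, by linarith⟩).1
  have hs' : s ∈ Ioi (0:ℝ) := hs
  have ht' : t ∈ Ioi (0:ℝ) := hs.trans_le hst
  have hkato := stub_vorticityUniformBounds_kato ν L hν hL u v p hsol htails s t hs hst
  rw [negMassLaw_negMass_eq hL hk (hsol.contDiff_u ht') (hsol.contDiff_v ht') (hsol.periodic_v t ht')
      (hsol.tendsto_u_atTop t ht') (hsol.tendsto_u_atBot t ht') hT,
    negMassLaw_negMass_eq hL hk (hsol.contDiff_u hs') (hsol.contDiff_v hs') (hsol.periodic_v s hs')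
      (hsol.tendsto_u_atTop s hs') (hsol.tendsto_u_atBot s hs') hS]
  linarith

end Summit.AnomalousDissipation.AnomalousDissipation.Theorems.StrainedLayerLaw.LogEnstrophyClock

end
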